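import Literature.Probability.Distributions.BrascampLiebInduction
import Literature.Probability.Moments.BrascampLiebVarianceProofs
import HarnessLib

/-!
# T4 — the `λ`-uniform Brascamp–Lieb–Poincaré inequality on cube windows (Euclidean model fibre)

`Literature/MathematicalPhysics/QuantumFieldTheory/Balaban1983to89/`, namespace
`Literature.MathematicalPhysics.QuantumFieldTheory.Balaban1983to89.T4CubePoincare`.
Row `T4-O3.E-i′-β-BLCUBE*` of the pub-balaban cell (lineage pv16, gen 11).

## HONEST FRAMING

Nothing in this file is printed in Bałaban's papers and nothing here is asserted about any of
his densities. It is a **[folklore] corollary of tree facts used BY NAME**, typed as the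
Euclidean MODEL of the variance input `(VAR)` left open by the covariance response
(`T4CovarianceResponse`, caveat (VAR); cell record GAPS G-pv16g11-4): for a windowed Gibbs law
`μ_K ∝ e^{-f} 1_K dx` on the cube `K = [-S,S]ⁿ ⊂ ℝⁿ` whose exponent `f ∈ C²(ℝⁿ)` has coordinate
Hessian `f_xx ≥ λ·1` (`λ > 0`), every `h ∈ C¹(ℝⁿ)` satisfies

  `Var_{μ_K}(h) ≤ λ⁻¹ · E_{μ_K} |∇h|²`.

The engine is the tree's kernel-proved cube form of Brascamp–Lieb 1976, Theorem 4.1 / eq. (4.11),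
`Literature.Probability.Distributions.bl_cube` (file `Distributions/BrascampLiebInduction`: the raw
inequality `(∫_K h² e^{-f})(∫_K e^{-f}) − (∫_K h e^{-f})² ≤ (∫_K ∇hᵀ f_xx⁻¹ ∇h e^{-f})(∫_K e^{-f})`
for `f ∈ C²` with positive-definite coordinate Hessian and `h ∈ C¹`), combined with the tree's
linear algebra `f_xx ≥ λ·1 ⇒ vᵀ f_xx⁻¹ v ≤ λ⁻¹ |v|²`
(`Literature.Probability.Moments.dotProduct_inv_mulVec_le_of_le_quadForm`,
`….le_fderiv_fderiv_of_uniformConvex`, file `Moments/BrascampLiebVarianceProofs`). Nothing of the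
Brascamp–Lieb cluster is re-proved or modified.

## CITATION HEADER

No page of [BrascampLieb1976] or of Bałaban's papers was read for this file; every declaration is
tagged [folklore] (a corollary of kernel-proved tree declarations, used by name). The printed
source behind the tree engine is H. J. Brascamp, E. H. Lieb, J. Funct. Anal. 22 (1976) 366–389,
Thm 4.1 / eq. (4.11), as cited IN THE TREE FILES (`[cite: BrascampLieb1976, Thm 4.1]` tags there),
not re-cited here.

## WHAT IS PROVED (CENSUS: 40 declarations — 7 definitions, 33 theorems; axioms
{propext, Classical.choice, Quot.sound})

* §1 the window `cube n S = [-S,S]ⁿ`, the convexity input `HessianBound f λ` (`λ|w|² ≤ wᵀ f_xx(x) w`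
  for all `x, w` — the second-order form; `hessianBound_of_firstOrder` derives it from the
  first-order `λ`-uniform convexity inequality of the tree's vendored statement), positive
  definiteness and the inverse bound, and STABILITY UNDER INTERPOLATION
  (`hessianBound_interp`: `a f₀ + b f₁`, `a, b ≥ 0`, `a + b = 1`, keeps the bound — one convexity
  input at the two endpoint exteriors serves the whole exponential interpolation path of
  `T4CovarianceResponse.pathLaw` in this model);
* §2 the RAW cube inequality with constant `λ⁻¹` (`blCube_uniform`);
* §3 the normalised forms: `cubeMass`, `cubeMean`, `cubeVar` (`= Var_{μ_K} h`), `cubeVar_le`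
  (`Var ≤ λ⁻¹ E|∇h|²`), the sup-gradient corollary `cubeVar_le_of_grad_le` (`Var ≤ λ⁻¹ G²` from
  `|∇h|² ≤ G²` on `K` — the shape of the `σ = b_H/√λ`, `τ = Lip/√λ` instances of
  `T4CovarianceResponse.respDom`'s slots), and the same statements for the windowed Gibbs
  PROBABILITY law `cubeLaw f S = (volume.restrict K).tilted (−f)` (Mathlib `Measure.tilted`):
  `variance_cubeLaw_le`, `variance_cubeLaw_le_of_grad_le`.

## CAVEATS

* (MODEL) The fibre here is `ℝⁿ` with Lebesgue measure and a cube window. Bałaban's one-step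
  fibre is a product of group copies `(s → G)` with Haar measure, read in the chart
  `y = B′⌈_s ∈ 𝔤^s`; a product over bonds of sup-norm balls of common radius in `𝔤 ≅ ℝ^{dim 𝔤}` is a
  cube, but the TRANSPORT (Haar density and BCH corrections, `λ = m_H − O(r)`) and the INPUTS
  `m_H`, `b_H` are NOT here (re-scoped row `T4-O3.E-iii-b-G7-BLWINDOW°`, yielded).
* (RAW) No integrability hypotheses: the cube is compact and all integrands are continuous; the
  matrix-form integrand of `bl_cube` is handled without a continuity claim on `f_xx⁻¹`
  (if it were not integrable its Bochner integral would be `0` and the bound still holds).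
* Value = kernel certificate that the tree already contains the convex-window variance input in
  the Euclidean model, down to transport and located constants — NOT summit progress.
-/

noncomputable section

open MeasureTheory Set Filter Matrix
open scoped Topology

namespace Literature.MathematicalPhysics.QuantumFieldTheory.Balaban1983to89.T4CubePoincare

open Literature.Probability.Distributions Literature.Probability.Moments

variable {n : ℕ}

/-! ## §1 The cube window and the convexity input -/

/-- The cube window `[-S,S]ⁿ ⊂ ℝⁿ` (the tree's `Set.pi univ fun _ => Icc (-S) S`). [folklore] -/
def cube (n : ℕ) (S : ℝ) : Set (Fin n → ℝ) :=
  Set.pi Set.univ fun (_ : Fin n) => Set.Icc (-S) S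

/-- Unfolding of `cube`. [folklore] -/
theorem cube_eq (n : ℕ) (S : ℝ) :
    cube n S = Set.pi Set.univ fun (_ : Fin n) => Set.Icc (-S) S := rfl

/-- Membership in the cube: all coordinates in `[-S,S]`. [folklore] -/
theorem mem_cube_iff {S : ℝ} {x : Fin n → ℝ} : x ∈ cube n S ↔ ∀ i, |x i| ≤ S := by
  rw [cube, Set.mem_univ_pi]
  simp only [Set.mem_Icc, abs_le]

/-- The cube is measurable. [folklore] -/
theorem measurableSet_cube' (n : ℕ) (S : ℝ) : MeasurableSet (cube n S) :=
  measurableSet_cube n S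

/-- The cube has positive volume for `S > 0`. [folklore] -/
theorem volume_cube_pos' (n : ℕ) {S : ℝ} (hS : 0 < S) : 0 < volume (cube n S) :=
  volume_cube_pos n hS

/-- Continuous functions are integrable on the cube. [folklore] -/
theorem integrableOn_cube' {ψ : (Fin n → ℝ) → ℝ} (hψ : Continuous ψ) (S : ℝ) :
    IntegrableOn ψ (cube n S) volume :=
  integrableOn_cube hψ S

/-- **The convexity input** (second-order form): the coordinate Hessian of `f` is bounded below
by `λ·1` everywhere, `λ (w·w) ≤ wᵀ f_xx(x) w`. This is the slot where print's strong convexity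
(B11 (142) at the critical point, the cell's whole-chart `B11HessianL2`) would be fed; nothing is
asserted about any printed exponent. [folklore] -/
def HessianBound (f : (Fin n → ℝ) → ℝ) (lam : ℝ) : Prop :=
  ∀ x w : Fin n → ℝ, lam * (w ⬝ᵥ w) ≤ w ⬝ᵥ (coordHessian f x *ᵥ w)

/-- For `f ∈ C²`, `Df` is differentiable. [folklore] -/
theorem differentiable_fderiv_of_contDiff_two {f : (Fin n → ℝ) → ℝ} (hf : ContDiff ℝ 2 f) :
    Differentiable ℝ (fderiv ℝ f) :=
  (hf.fderiv_right (m := 1) (by norm_num)).differentiable (by norm_num)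

/-- Entries of the coordinate Hessian of a `C²` function are the values of `D²f` on the standard
basis (tree: `coordHessian_apply_eq`). [folklore] -/
theorem coordHessian_entry {f : (Fin n → ℝ) → ℝ} (hf : ContDiff ℝ 2 f) (x : Fin n → ℝ)
    (i j : Fin n) :
    coordHessian f x i j = fderiv ℝ (fderiv ℝ f) x (Pi.single i 1) (Pi.single j 1) :=
  coordHessian_apply_eq (differentiable_fderiv_of_contDiff_two hf x) i j

/-- The quadratic form of the coordinate Hessian is the second derivative on the diagonal:
`wᵀ f_xx(x) w = D²f(x)(w,w)` (tree: `bilin_apply_eq_sum_single`). [folklore] -/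
theorem quadForm_coordHessian {f : (Fin n → ℝ) → ℝ} (hf : ContDiff ℝ 2 f) (x w : Fin n → ℝ) :
    w ⬝ᵥ (coordHessian f x *ᵥ w) = fderiv ℝ (fderiv ℝ f) x w w := by
  rw [bilin_apply_eq_sum_single (fderiv ℝ (fderiv ℝ f) x) w w]
  simp only [dotProduct, Matrix.mulVec, coordHessian_entry hf]

/-- For `f ∈ C²` the Hessian bound reads `λ|w|² ≤ D²f(x)(w,w)`. [folklore] -/
theorem hessianBound_iff_fderiv {f : (Fin n → ℝ) → ℝ} (hf : ContDiff ℝ 2 f) {lam : ℝ} :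
    HessianBound f lam ↔ ∀ x w : Fin n → ℝ, lam * (w ⬝ᵥ w) ≤ fderiv ℝ (fderiv ℝ f) x w w := by
  unfold HessianBound
  constructor
  · intro h x w
    rw [← quadForm_coordHessian hf]
    exact h x w
  · intro h x w
    rw [quadForm_coordHessian hf]
    exact h x w

/-- The first-order `λ`-uniform convexity inequality
`f y ≥ f x + Df(x)(y − x) + (λ/2)|y − x|²` (the form of the tree's vendored statement
`BrascampLieb1976_thm41_uniform`) gives the Hessian bound, by the tree's
`le_fderiv_fderiv_of_uniformConvex`. [folklore] -/
theorem hessianBound_of_firstOrder {f : (Fin n → ℝ) → ℝ} (hf : ContDiff ℝ 2 f) {lam : ℝ}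
    (hconv : ∀ x y : Fin n → ℝ,
      f x + fderiv ℝ f x (y - x) + lam / 2 * ((y - x) ⬝ᵥ (y - x)) ≤ f y) :
    HessianBound f lam :=
  (hessianBound_iff_fderiv hf).2 fun x w => le_fderiv_fderiv_of_uniformConvex hf hconv x w

/-- A positive Hessian bound makes the coordinate Hessian positive definite everywhere (the
hypothesis of the tree's `bl_cube`). [folklore] -/
theorem posDef_of_hessianBound {f : (Fin n → ℝ) → ℝ} (hf : ContDiff ℝ 2 f) {lam : ℝ}
    (hlam : 0 < lam) (hB : HessianBound f lam) (x : Fin n → ℝ) : (coordHessian f x).PosDef := by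
  refine Matrix.PosDef.of_dotProduct_mulVec_pos ?_ fun w hw => ?_
  · refine Matrix.IsHermitian.ext fun i j => ?_
    rw [star_trivial, coordHessian_entry hf, coordHessian_entry hf]
    exact hf.contDiffAt.isSymmSndFDerivAt (by simp) _ _
  · rw [star_trivial]
    have hwpos : 0 < w ⬝ᵥ w := by
      have := Matrix.dotProduct_star_self_pos_iff.mpr hw
      rwa [star_trivial] at this
    exact lt_of_lt_of_le (mul_pos hlam hwpos) (hB x w)

/-- The inverse bound `vᵀ f_xx(x)⁻¹ v ≤ λ⁻¹ |v|²` (tree: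
`dotProduct_inv_mulVec_le_of_le_quadForm`). [folklore] -/
theorem inv_quadForm_le {f : (Fin n → ℝ) → ℝ} (hf : ContDiff ℝ 2 f) {lam : ℝ} (hlam : 0 < lam)
    (hB : HessianBound f lam) (x v : Fin n → ℝ) :
    v ⬝ᵥ ((coordHessian f x)⁻¹ *ᵥ v) ≤ lam⁻¹ * (v ⬝ᵥ v) := by
  have hdet : IsUnit (coordHessian f x).det :=
    isUnit_iff_ne_zero.2 (posDef_of_hessianBound hf hlam hB x).det_pos.ne'
  exact dotProduct_inv_mulVec_le_of_le_quadForm hdet hlam (hB x) v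

/-- Second derivative of an affine combination of two `C²` functions. [folklore] -/
theorem fderiv_fderiv_combo {f₀ f₁ : (Fin n → ℝ) → ℝ} (hf₀ : ContDiff ℝ 2 f₀)
    (hf₁ : ContDiff ℝ 2 f₁) (a b : ℝ) (x v w : Fin n → ℝ) :
    fderiv ℝ (fderiv ℝ (fun y => a * f₀ y + b * f₁ y)) x v w =
      a * fderiv ℝ (fderiv ℝ f₀) x v w + b * fderiv ℝ (fderiv ℝ f₁) x v w := by
  have hd₀ : Differentiable ℝ f₀ := hf₀.differentiable (by norm_num)
  have hd₁ : Differentiable ℝ f₁ := hf₁.differentiable (by norm_num)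
  have hD₀ : Differentiable ℝ (fderiv ℝ f₀) := differentiable_fderiv_of_contDiff_two hf₀
  have hD₁ : Differentiable ℝ (fderiv ℝ f₁) := differentiable_fderiv_of_contDiff_two hf₁
  have h1 : fderiv ℝ (fun y => a * f₀ y + b * f₁ y) = a • fderiv ℝ f₀ + b • fderiv ℝ f₁ := by
    funext y
    exact (((hd₀ y).hasFDerivAt.const_mul a).add ((hd₁ y).hasFDerivAt.const_mul b)).fderiv
  have h2 : fderiv ℝ (a • fderiv ℝ f₀ + b • fderiv ℝ f₁) x =
      a • fderiv ℝ (fderiv ℝ f₀) x + b • fderiv ℝ (fderiv ℝ f₁) x :=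
    (((hD₀ x).hasFDerivAt.const_smul a).add ((hD₁ x).hasFDerivAt.const_smul b)).fderiv
  rw [h1, h2]
  simp [smul_eq_mul]

/-- An affine combination of two `C²` functions is `C²`. [folklore] -/
theorem contDiff_combo {f₀ f₁ : (Fin n → ℝ) → ℝ} (hf₀ : ContDiff ℝ 2 f₀) (hf₁ : ContDiff ℝ 2 f₁)
    (a b : ℝ) : ContDiff ℝ 2 (fun y => a * f₀ y + b * f₁ y) :=
  (contDiff_const.mul hf₀).add (contDiff_const.mul hf₁)

/-- **Stability under interpolation**: if `f₀, f₁ ∈ C²` both have Hessian `≥ λ·1`, so does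
`a f₀ + b f₁` for `a, b ≥ 0`, `a + b = 1` — in particular the exponential-interpolation exponent
`(1 − θ) f₀ + θ f₁`, `θ ∈ [0,1]`, of `T4CovarianceResponse.pathLaw` in this model. [folklore] -/
theorem hessianBound_interp {f₀ f₁ : (Fin n → ℝ) → ℝ} (hf₀ : ContDiff ℝ 2 f₀)
    (hf₁ : ContDiff ℝ 2 f₁) {lam : ℝ} (h₀ : HessianBound f₀ lam) (h₁ : HessianBound f₁ lam)
    {a b : ℝ} (ha : 0 ≤ a) (hb : 0 ≤ b) (hab : a + b = 1) :
    HessianBound (fun y => a * f₀ y + b * f₁ y) lam := by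
  rw [hessianBound_iff_fderiv (contDiff_combo hf₀ hf₁ a b)]
  intro x w
  rw [fderiv_fderiv_combo hf₀ hf₁]
  have e₀ := (hessianBound_iff_fderiv hf₀).1 h₀ x w
  have e₁ := (hessianBound_iff_fderiv hf₁).1 h₁ x w
  have : lam * (w ⬝ᵥ w) = a * (lam * (w ⬝ᵥ w)) + b * (lam * (w ⬝ᵥ w)) := by
    rw [← add_mul, hab, one_mul]
  rw [this]
  exact add_le_add (mul_le_mul_of_nonneg_left e₀ ha) (mul_le_mul_of_nonneg_left e₁ hb)

/-- The interpolation exponent on `[0,1]`: `θ ↦ (1 − θ) f₀ + θ f₁` keeps the Hessian bound for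
`θ ∈ [0,1]`. [folklore] -/
theorem hessianBound_interp_Icc {f₀ f₁ : (Fin n → ℝ) → ℝ} (hf₀ : ContDiff ℝ 2 f₀)
    (hf₁ : ContDiff ℝ 2 f₁) {lam : ℝ} (h₀ : HessianBound f₀ lam) (h₁ : HessianBound f₁ lam)
    {θ : ℝ} (hθ : θ ∈ Set.Icc (0 : ℝ) 1) :
    HessianBound (fun y => (1 - θ) * f₀ y + θ * f₁ y) lam :=
  hessianBound_interp hf₀ hf₁ h₀ h₁ (by linarith [hθ.2]) hθ.1 (by ring)

/-! ## §2 The raw cube inequality with constant `λ⁻¹` -/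

/-- Continuity of `x ↦ |∇h(x)|²`. [folklore] -/
theorem continuous_gradSq {h : (Fin n → ℝ) → ℝ} (hh : ContDiff ℝ 1 h) :
    Continuous fun x => coordGradient h x ⬝ᵥ coordGradient h x := by
  have hc := continuous_coordGradient hh
  unfold dotProduct
  refine continuous_finsetSum _ fun i _ => ?_
  exact ((continuous_apply i).comp hc).mul ((continuous_apply i).comp hc)

/-- The cube mass `Z_K = ∫_K e^{-f}` is positive (`S > 0`). [folklore] -/
theorem setIntegral_exp_neg_pos {f : (Fin n → ℝ) → ℝ} (hf : Continuous f) {S : ℝ} (hS : 0 < S) :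
    0 < ∫ x in cube n S, Real.exp (-f x) :=
  setIntegral_cube_pos (continuous_expNeg hf) (fun _ => Real.exp_pos _) hS

/-- The matrix-form Dirichlet integral of `bl_cube` is at most `λ⁻¹` times the plain one.
[folklore] -/
theorem setIntegral_invQuad_le {f h : (Fin n → ℝ) → ℝ} (hf : ContDiff ℝ 2 f) {lam : ℝ}
    (hlam : 0 < lam) (hB : HessianBound f lam) (hh : ContDiff ℝ 1 h) (S : ℝ) :
    (∫ x in cube n S, (coordGradient h x ⬝ᵥ ((coordHessian f x)⁻¹ *ᵥ coordGradient h x)) *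
        Real.exp (-f x)) ≤
      lam⁻¹ * ∫ x in cube n S, (coordGradient h x ⬝ᵥ coordGradient h x) * Real.exp (-f x) := by
  have hint2 : IntegrableOn (fun x => (coordGradient h x ⬝ᵥ coordGradient h x) * Real.exp (-f x))
      (cube n S) volume :=
    integrableOn_cube' ((continuous_gradSq hh).mul (continuous_expNeg hf.continuous)) S
  by_cases hint : IntegrableOn (fun x =>
      (coordGradient h x ⬝ᵥ ((coordHessian f x)⁻¹ *ᵥ coordGradient h x)) * Real.exp (-f x))
      (cube n S) volume
  · rw [← integral_const_mul]
    refine setIntegral_mono hint (hint2.const_mul _) fun x => ?_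
    have hx := inv_quadForm_le hf hlam hB x (coordGradient h x)
    have hexp : 0 ≤ Real.exp (-f x) := (Real.exp_pos _).le
    calc (coordGradient h x ⬝ᵥ ((coordHessian f x)⁻¹ *ᵥ coordGradient h x)) * Real.exp (-f x)
        ≤ (lam⁻¹ * (coordGradient h x ⬝ᵥ coordGradient h x)) * Real.exp (-f x) :=
          mul_le_mul_of_nonneg_right hx hexp
      _ = lam⁻¹ * ((coordGradient h x ⬝ᵥ coordGradient h x) * Real.exp (-f x)) := by ring
  · rw [integral_undef hint]
    exact mul_nonneg (inv_nonneg.2 hlam.le) (setIntegral_nonneg (measurableSet_cube' n S)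
      fun x _ => mul_nonneg (Finset.sum_nonneg fun _ _ => mul_self_nonneg _) (Real.exp_pos _).le)

/-- **The `λ`-uniform Brascamp–Lieb–Poincaré inequality on the cube, raw form**: for `S > 0`,
`λ > 0`, `f ∈ C²(ℝⁿ)` with `f_xx ≥ λ·1` and `h ∈ C¹(ℝⁿ)`,
`(∫_K h² e^{-f})(∫_K e^{-f}) − (∫_K h e^{-f})² ≤ λ⁻¹ (∫_K |∇h|² e^{-f})(∫_K e^{-f})`, `K = [-S,S]ⁿ`.
From the tree's `bl_cube` BY NAME and `setIntegral_invQuad_le`. [folklore] -/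
theorem blCube_uniform {S lam : ℝ} (hS : 0 < S) (hlam : 0 < lam) {f h : (Fin n → ℝ) → ℝ}
    (hf : ContDiff ℝ 2 f) (hB : HessianBound f lam) (hh : ContDiff ℝ 1 h) :
    (∫ x in cube n S, h x ^ 2 * Real.exp (-f x)) * (∫ x in cube n S, Real.exp (-f x)) -
        (∫ x in cube n S, h x * Real.exp (-f x)) ^ 2 ≤
      lam⁻¹ * (∫ x in cube n S, (coordGradient h x ⬝ᵥ coordGradient h x) * Real.exp (-f x)) *
        (∫ x in cube n S, Real.exp (-f x)) := by
  have key :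
      (∫ x in cube n S, h x ^ 2 * Real.exp (-f x)) * (∫ x in cube n S, Real.exp (-f x)) -
          (∫ x in cube n S, h x * Real.exp (-f x)) ^ 2 ≤
        (∫ x in cube n S, (coordGradient h x ⬝ᵥ ((coordHessian f x)⁻¹ *ᵥ coordGradient h x)) *
            Real.exp (-f x)) * (∫ x in cube n S, Real.exp (-f x)) :=
    bl_cube hS n f h hf (posDef_of_hessianBound hf hlam hB) hh
  have hZ : 0 ≤ ∫ x in cube n S, Real.exp (-f x) :=
    (setIntegral_exp_neg_pos hf.continuous hS).le
  exact key.trans (mul_le_mul_of_nonneg_right (setIntegral_invQuad_le hf hlam hB hh S) hZ)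

/-! ## §3 Normalised forms: the windowed Gibbs law on the cube -/

/-- The cube mass `Z_K(f) = ∫_K e^{-f}`. [folklore] -/
def cubeMass (f : (Fin n → ℝ) → ℝ) (S : ℝ) : ℝ := ∫ x in cube n S, Real.exp (-f x)

/-- The cube mean `⟨h⟩_K = (∫_K h e^{-f}) / Z_K`. [folklore] -/
def cubeMean (f : (Fin n → ℝ) → ℝ) (S : ℝ) (h : (Fin n → ℝ) → ℝ) : ℝ :=
  (∫ x in cube n S, h x * Real.exp (-f x)) / cubeMass f S

/-- The cube variance `Var_K(h) = (∫_K (h − ⟨h⟩_K)² e^{-f}) / Z_K`. [folklore] -/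
def cubeVar (f : (Fin n → ℝ) → ℝ) (S : ℝ) (h : (Fin n → ℝ) → ℝ) : ℝ :=
  (∫ x in cube n S, (h x - cubeMean f S h) ^ 2 * Real.exp (-f x)) / cubeMass f S

/-- The cube Dirichlet energy `⟨|∇h|²⟩_K = (∫_K |∇h|² e^{-f}) / Z_K`. [folklore] -/
def cubeGradSq (f : (Fin n → ℝ) → ℝ) (S : ℝ) (h : (Fin n → ℝ) → ℝ) : ℝ :=
  (∫ x in cube n S, (coordGradient h x ⬝ᵥ coordGradient h x) * Real.exp (-f x)) / cubeMass f S

/-- `Z_K > 0`. [folklore] -/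
theorem cubeMass_pos {f : (Fin n → ℝ) → ℝ} (hf : Continuous f) {S : ℝ} (hS : 0 < S) :
    0 < cubeMass f S :=
  setIntegral_exp_neg_pos hf hS

/-- The centred second moment in terms of raw moments:
`∫_K (h − m)² e^{-f} = B − 2 m A + m² Z`. [folklore] -/
theorem setIntegral_sub_sq {f h : (Fin n → ℝ) → ℝ} (hf : Continuous f) (hh : Continuous h)
    (S m : ℝ) :
    ∫ x in cube n S, (h x - m) ^ 2 * Real.exp (-f x) =
      (∫ x in cube n S, h x ^ 2 * Real.exp (-f x)) - 2 * m * (∫ x in cube n S, h x * Real.exp (-f x))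
        + m ^ 2 * ∫ x in cube n S, Real.exp (-f x) := by
  have hE : Continuous fun x => Real.exp (-f x) := continuous_expNeg hf
  have i0 : IntegrableOn (fun x => Real.exp (-f x)) (cube n S) volume := integrableOn_cube' hE S
  have i1 : IntegrableOn (fun x => h x * Real.exp (-f x)) (cube n S) volume :=
    integrableOn_cube' (hh.mul hE) S
  have i2 : IntegrableOn (fun x => h x ^ 2 * Real.exp (-f x)) (cube n S) volume :=
    integrableOn_cube' ((hh.pow 2).mul hE) S
  have e : ∀ x, (h x - m) ^ 2 * Real.exp (-f x) =
      h x ^ 2 * Real.exp (-f x) - 2 * m * (h x * Real.exp (-f x)) + m ^ 2 * Real.exp (-f x) := by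
    intro x; ring
  have iF : Integrable (fun x => h x ^ 2 * Real.exp (-f x) - 2 * m * (h x * Real.exp (-f x)))
      (volume.restrict (cube n S)) := i2.sub (i1.const_mul _)
  simp_rw [e]
  rw [integral_add iF (i0.const_mul _), integral_sub i2 (i1.const_mul _), integral_const_mul,
    integral_const_mul]

/-- **Normalised cube Poincaré inequality**: `Var_K(h) ≤ λ⁻¹ ⟨|∇h|²⟩_K`. [folklore] -/
theorem cubeVar_le {S lam : ℝ} (hS : 0 < S) (hlam : 0 < lam) {f h : (Fin n → ℝ) → ℝ}
    (hf : ContDiff ℝ 2 f) (hB : HessianBound f lam) (hh : ContDiff ℝ 1 h) :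
    cubeVar f S h ≤ lam⁻¹ * cubeGradSq f S h := by
  have hZ : 0 < cubeMass f S := cubeMass_pos hf.continuous hS
  have key := blCube_uniform hS hlam hf hB hh
  have hexp := setIntegral_sub_sq hf.continuous hh.continuous S (cubeMean f S h)
  unfold cubeVar cubeGradSq
  rw [hexp]
  unfold cubeMean cubeMass at *
  set Z : ℝ := ∫ x in cube n S, Real.exp (-f x) with hZdef
  set A : ℝ := ∫ x in cube n S, h x * Real.exp (-f x) with hAdef
  set B : ℝ := ∫ x in cube n S, h x ^ 2 * Real.exp (-f x) with hBdef
  set D : ℝ := ∫ x in cube n S, (coordGradient h x ⬝ᵥ coordGradient h x) * Real.exp (-f x)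
    with hDdef
  have hZne : Z ≠ 0 := hZ.ne'
  rw [div_le_iff₀ hZ]
  have e1 : B - 2 * (A / Z) * A + (A / Z) ^ 2 * Z = (B * Z - A ^ 2) / Z := by
    field_simp
    ring
  have e2 : lam⁻¹ * (D / Z) * Z = (lam⁻¹ * D * Z) / Z := by
    field_simp
  rw [e1, e2]
  exact div_le_div_of_nonneg_right key hZ.le

/-- The Dirichlet energy under a pointwise gradient bound on the window:
`|∇h|² ≤ G²` on `K` gives `⟨|∇h|²⟩_K ≤ G²`. [folklore] -/
theorem cubeGradSq_le_of_grad_le {S : ℝ} (hS : 0 < S) {f h : (Fin n → ℝ) → ℝ} (hf : Continuous f)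
    (hh : ContDiff ℝ 1 h) {G : ℝ}
    (hG : ∀ x ∈ cube n S, coordGradient h x ⬝ᵥ coordGradient h x ≤ G ^ 2) :
    cubeGradSq f S h ≤ G ^ 2 := by
  have hZ : 0 < cubeMass f S := cubeMass_pos hf hS
  unfold cubeGradSq
  rw [div_le_iff₀ hZ]
  unfold cubeMass
  rw [← integral_const_mul]
  have hE : Continuous fun x => Real.exp (-f x) := continuous_expNeg hf
  refine setIntegral_mono_on (integrableOn_cube' ((continuous_gradSq hh).mul hE) S)
    ((integrableOn_cube' hE S).const_mul _) (measurableSet_cube' n S) fun x hx => ?_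
  exact mul_le_mul_of_nonneg_right (hG x hx) (Real.exp_pos _).le

/-- **Sup-gradient corollary**: `Var_K(h) ≤ λ⁻¹ G²` when `|∇h|² ≤ G²` on the window — the shape
of the instances `σ = b_H/√λ` (for the exponent gap, `G = b_H·dev`) and `τ = Lip(F)/√λ` of the
variance slots of `T4CovarianceResponse.respDom`, in the Euclidean model. [folklore] -/
theorem cubeVar_le_of_grad_le {S lam : ℝ} (hS : 0 < S) (hlam : 0 < lam) {f h : (Fin n → ℝ) → ℝ}
    (hf : ContDiff ℝ 2 f) (hB : HessianBound f lam) (hh : ContDiff ℝ 1 h) {G : ℝ}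
    (hG : ∀ x ∈ cube n S, coordGradient h x ⬝ᵥ coordGradient h x ≤ G ^ 2) :
    cubeVar f S h ≤ lam⁻¹ * G ^ 2 :=
  (cubeVar_le hS hlam hf hB hh).trans
    (mul_le_mul_of_nonneg_left (cubeGradSq_le_of_grad_le hS hf.continuous hh hG)
      (inv_nonneg.2 hlam.le))

/-! ### The windowed Gibbs probability law `μ_K = e^{-f} 1_K dx / Z_K` -/

/-- The windowed Gibbs law on the cube, as a Mathlib tilted measure:
`cubeLaw f S = (volume.restrict K).tilted (−f)`. [folklore] -/
def cubeLaw (f : (Fin n → ℝ) → ℝ) (S : ℝ) : Measure (Fin n → ℝ) :=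
  (volume.restrict (cube n S)).tilted fun x => -f x

/-- `cubeLaw` is a probability measure (`S > 0`, `f` continuous). [folklore] -/
theorem isProbabilityMeasure_cubeLaw {f : (Fin n → ℝ) → ℝ} (hf : Continuous f) {S : ℝ}
    (hS : 0 < S) : IsProbabilityMeasure (cubeLaw f S) := by
  haveI : NeZero (volume.restrict (cube n S) : Measure (Fin n → ℝ)) :=
    ⟨fun h0 => (volume_cube_pos' n hS).ne' (Measure.restrict_eq_zero.1 h0)⟩
  exact isProbabilityMeasure_tilted (integrableOn_cube' (continuous_expNeg hf) S)

/-- Integrals against `cubeLaw` are normalised windowed Gibbs integrals: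
`∫ φ dμ_K = (∫_K φ e^{-f}) / Z_K`. [folklore] -/
theorem integral_cubeLaw (f : (Fin n → ℝ) → ℝ) (S : ℝ) (φ : (Fin n → ℝ) → ℝ) :
    ∫ x, φ x ∂(cubeLaw f S) = (∫ x in cube n S, φ x * Real.exp (-f x)) / cubeMass f S := by
  unfold cubeLaw cubeMass
  rw [integral_tilted, ← integral_div]
  congr 1
  ext x
  rw [smul_eq_mul]
  ring

/-- The mean under `cubeLaw` is the cube mean. [folklore] -/
theorem integral_cubeLaw_eq_cubeMean (f : (Fin n → ℝ) → ℝ) (S : ℝ) (h : (Fin n → ℝ) → ℝ) :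
    ∫ x, h x ∂(cubeLaw f S) = cubeMean f S h :=
  integral_cubeLaw f S h

/-- The variance under `cubeLaw` is the cube variance. [folklore] -/
theorem variance_cubeLaw_eq (f : (Fin n → ℝ) → ℝ) (S : ℝ) (h : (Fin n → ℝ) → ℝ) :
    ∫ x, (h x - ∫ y, h y ∂(cubeLaw f S)) ^ 2 ∂(cubeLaw f S) = cubeVar f S h := by
  have hm : ∫ y, h y ∂(cubeLaw f S) = cubeMean f S h := integral_cubeLaw_eq_cubeMean f S h
  simp_rw [hm]
  rw [integral_cubeLaw]
  rfl

/-- The Dirichlet energy under `cubeLaw` is the cube Dirichlet energy. [folklore] -/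
theorem gradSq_cubeLaw_eq (f : (Fin n → ℝ) → ℝ) (S : ℝ) (h : (Fin n → ℝ) → ℝ) :
    ∫ x, (coordGradient h x ⬝ᵥ coordGradient h x) ∂(cubeLaw f S) = cubeGradSq f S h :=
  integral_cubeLaw f S _

/-- **The `λ`-uniform Brascamp–Lieb–Poincaré inequality for the windowed Gibbs law on the
cube**: `∫ (h − ∫ h dμ_K)² dμ_K ≤ λ⁻¹ ∫ |∇h|² dμ_K` for `μ_K ∝ e^{-f} 1_{[-S,S]ⁿ} dx`, `f ∈ C²` with
`f_xx ≥ λ·1`, `h ∈ C¹`. [folklore] -/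
theorem variance_cubeLaw_le {S lam : ℝ} (hS : 0 < S) (hlam : 0 < lam) {f h : (Fin n → ℝ) → ℝ}
    (hf : ContDiff ℝ 2 f) (hB : HessianBound f lam) (hh : ContDiff ℝ 1 h) :
    ∫ x, (h x - ∫ y, h y ∂(cubeLaw f S)) ^ 2 ∂(cubeLaw f S) ≤
      lam⁻¹ * ∫ x, (coordGradient h x ⬝ᵥ coordGradient h x) ∂(cubeLaw f S) := by
  rw [variance_cubeLaw_eq, gradSq_cubeLaw_eq]
  exact cubeVar_le hS hlam hf hB hh

/-- The same with a pointwise gradient bound on the window: `Var_{μ_K}(h) ≤ λ⁻¹ G²`. [folklore] -/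
theorem variance_cubeLaw_le_of_grad_le {S lam : ℝ} (hS : 0 < S) (hlam : 0 < lam)
    {f h : (Fin n → ℝ) → ℝ} (hf : ContDiff ℝ 2 f) (hB : HessianBound f lam) (hh : ContDiff ℝ 1 h)
    {G : ℝ} (hG : ∀ x ∈ cube n S, coordGradient h x ⬝ᵥ coordGradient h x ≤ G ^ 2) :
    ∫ x, (h x - ∫ y, h y ∂(cubeLaw f S)) ^ 2 ∂(cubeLaw f S) ≤ lam⁻¹ * G ^ 2 := by
  rw [variance_cubeLaw_eq]
  exact cubeVar_le_of_grad_le hS hlam hf hB hh hG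

/-- **Along the interpolation path**: for two exponents `f₀, f₁ ∈ C²` with `f_xx ≥ λ·1` and every
`θ ∈ [0,1]`, the windowed Gibbs law of `(1−θ) f₀ + θ f₁` satisfies the same Poincaré inequality —
the `∀ θ ∈ Icc 0 1` shape of the variance slots of `T4CovarianceResponse.respDom`, in the model.
[folklore] -/
theorem variance_cubeLaw_interp_le {S lam : ℝ} (hS : 0 < S) (hlam : 0 < lam)
    {f₀ f₁ h : (Fin n → ℝ) → ℝ} (hf₀ : ContDiff ℝ 2 f₀) (hf₁ : ContDiff ℝ 2 f₁)
    (h₀ : HessianBound f₀ lam) (h₁ : HessianBound f₁ lam) (hh : ContDiff ℝ 1 h)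
    {θ : ℝ} (hθ : θ ∈ Set.Icc (0 : ℝ) 1) :
    ∫ x, (h x - ∫ y, h y ∂(cubeLaw (fun y => (1 - θ) * f₀ y + θ * f₁ y) S)) ^ 2
        ∂(cubeLaw (fun y => (1 - θ) * f₀ y + θ * f₁ y) S) ≤
      lam⁻¹ * ∫ x, (coordGradient h x ⬝ᵥ coordGradient h x)
        ∂(cubeLaw (fun y => (1 - θ) * f₀ y + θ * f₁ y) S) :=
  variance_cubeLaw_le hS hlam (contDiff_combo hf₀ hf₁ _ _) (hessianBound_interp_Icc hf₀ hf₁ h₀ h₁ hθ)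
    hh

end Literature.MathematicalPhysics.QuantumFieldTheory.Balaban1983to89.T4CubePoincare

end
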